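import Summits.CriticalPhenomena.SAWScalingLimit.Theorems.SAWDevelopingMapObservableToSLEChordalCarrierCollarData

/-!
# Crux `SAWDevelopingMap.ObservableToSLE` (stmt-CriticalPhenomena-10472), line
`floor-ratio-restriction-bootstrap`, stub `stub_chordalCarrier`: COLLAR FAMILIES from lattice
restriction limits (the conformal-geometric input of boundary avoidance)

Landing target:
`Summits/CriticalPhenomena/SAWScalingLimit/Theorems/SAWDevelopingMapObservableToSLEChordalCarrierCollars.lean`
(`--supports stmt-CriticalPhenomena-10472`).  Sequel of `…ChordalCarrierCollarData` (half-ellipse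
collar data on the half-plane side).

The reduction `stub_chordalCarrier_reduction` (file `…ChordalCarrierReduction`) derives the
conclusion of the stub from two inputs; this file PROVES the second one from the per-domain form of
the stub's hypothesis `FloorRestrictionLimit` (the same hypothesis shape as in
`stub_restrictionIdentifies`): **if, for every hull subdomain `D' = φ(ℍ ∖ A)` of `(D; a, b)` with
restriction data `(Φ_A, Φ'_A(0) = d)`, the `hexSAWLaw`-probability that the walk is a `D'`-mesh walk
tends to `d^{5/8}`, then every boundary piece `frontierPiece D k = ∂D ∖ (B(a,1/(k+1)) ∪ B(b,1/(k+1)))`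
is covered by two compact sets `ψ[r, R]`, `ψ[-R, -r]` (`ψ` the boundary extension of a chordal
uniformizing map `φ`, `0 < r < R`), each avoided by the closures of a sequence of hull subdomains
whose containment probabilities tend to `1`** (`stub_chordalCarrier_collars`).  Ingredients:

* `disjoint_closure_image` — Carathéodory's disc extension `Ψ` (`JordanDomain.IsDiscExtension`:
  a continuous bijection of the closed disc onto `cl D`) shows `cl φ(ℍ ∖ J) ∩ ψ(K) = ∅` whenever
  the hull `J` contains the `cl ℍ`-part of an open neighbourhood of `K ⊆ cl ℍ`;
* `exists_Icc_cover_frontierPiece` — `Ψ` maps the circle ONTO `∂D` with `Ψ(1) = b`,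
  `Ψ(-1) = Ψ(C 0) = a` (`C` the Cayley map), so the circle parameters of a boundary piece form a
  closed set off `±1`, whence real parameters with `|x| ∈ [ε/2, 2/ε]`;
* `exists_hullSubdomain_collar`, `exists_collarFamily` — smooth hulls are pull-backs of Jordan
  hull subdomains (`exists_isHullSubdomain_of_isArcHull`, Jordan curve theorem and Carathéodory
  `_holds`), to which the restriction limits apply; `p_j = d_j^{5/8} → 1`.
-/

noncomputable section

open scoped Topology NNReal ENNReal
open Filter Set MeasureTheory Metric Complex
open UpperHalfPlane (upperHalfPlaneSet isOpen_upperHalfPlaneSet)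
open Literature.Probability.LatticeModels (HexVertex hexGraph hexCenter)
open Literature.Probability.RandomPlanarGeometry
open Literature.Probability.RandomPlanarGeometry.SAW
open Literature.Topology.PlaneTopology (JordanCurveTheorem_holds)

namespace Summit.CriticalPhenomena.SAWScalingLimit.Theorems.ObservableToSLE.FloorRatio

/-! ### The disc picture: closure avoidance and localisation of boundary pieces -/

section Boundary

variable {D : DobrushinDomain} {φ : ConformalEquiv upperHalfPlaneSet D.carrier} {Ψ : ℂ → ℂ}

/-- **Closure avoidance.** If the hull `J` contains the `cl ℍ`-part of an open neighbourhood `N`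
of a set `K ⊆ cl ℍ`, then the closure of `φ(ℍ ∖ J)` misses the boundary image `ψ(K)`
(Carathéodory: `φ = Ψ ∘ C` with `Ψ` a continuous injection of the closed disc; a limit point
`Ψ(q)`, `q ∈ cl C(ℍ ∖ J)`, equal to `ψ(x) = Ψ(C x)` forces `q = C x`, but `C⁻¹` is continuous at
`C x ≠ 1` and pulls a neighbourhood back into `N`). [cite: PommerenkeBBCM1992, Thm. 2.6] -/
theorem disjoint_closure_image (h : JordanDomain.IsDiscExtension D.toJordanDomain φ Ψ)
    {J N K : Set ℂ} (hN : IsOpen N) (hNJ : ∀ z ∈ N, 0 ≤ z.im → z ∈ J) (hK : K ⊆ N)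
    (hKim : ∀ z ∈ K, 0 ≤ z.im) :
    Disjoint (closure (φ '' (upperHalfPlaneSet \ J))) (φ.boundaryExtension '' K) := by
  set S : Set ℂ := cayleyFun '' (upperHalfPlaneSet \ J) with hS
  have hSball : S ⊆ closedBall (0 : ℂ) 1 := by
    rintro _ ⟨z, hz, rfl⟩
    exact mem_closedBall_zero_iff.2 (norm_cayleyFun_le_one (show (0 : ℝ) < z.im from hz.1).le)
  have hφS : φ '' (upperHalfPlaneSet \ J) = Ψ '' S := by
    rw [hS, image_image]
    exact image_congr fun z hz ↦ JordanDomain.eqOn_comp_cayleyFun φ h.eqOn hz.1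
  have hclS : closure S ⊆ closedBall (0 : ℂ) 1 := closure_minimal hSball isClosed_closedBall
  have hcl : closure (φ '' (upperHalfPlaneSet \ J)) ⊆ Ψ '' closure S := by
    rw [hφS]
    exact closure_minimal (image_mono subset_closure)
      (((isCompact_closedBall (0 : ℂ) 1).of_isClosed_subset isClosed_closure hclS).image_of_continuousOn
        (h.continuousOn.mono hclS)).isClosed
  refine Set.disjoint_left.2 fun w hw hwK ↦ ?_
  obtain ⟨x, hxK, rfl⟩ := hwK
  obtain ⟨q, hq, hqw⟩ := hcl hw
  have hx0 : 0 ≤ x.im := hKim x hxK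
  rw [h.boundaryExtension_eq hx0] at hqw
  have hCx : cayleyFun x ∈ closedBall (0 : ℂ) 1 :=
    mem_closedBall_zero_iff.2 (norm_cayleyFun_le_one hx0)
  have hqC : q = cayleyFun x := h.bijOn.injOn (hclS hq) hCx hqw
  have hC1 : cayleyFun x ≠ 1 := cayleyFun_ne_one _
  have hcont : ContinuousAt cayleyInvFun (cayleyFun x) :=
    differentiableOn_cayleyInvFun.continuousOn.continuousAt (isOpen_ne.mem_nhds hC1)
  have hxinv : cayleyInvFun (cayleyFun x) = x := cayleyInvFun_cayleyFun (add_I_ne_zero hx0)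
  have hpre : cayleyInvFun ⁻¹' N ∈ 𝓝 (cayleyFun x) :=
    hcont.preimage_mem_nhds (by rw [hxinv]; exact hN.mem_nhds (hK hxK))
  rw [hqC, mem_closure_iff_nhds] at hq
  obtain ⟨ζ, hζV, hζS⟩ := hq _ hpre
  obtain ⟨z, hz, rfl⟩ := hζS
  have hz0 : 0 ≤ z.im := (show (0 : ℝ) < z.im from hz.1).le
  have hzN : z ∈ N := by
    have : cayleyInvFun (cayleyFun z) ∈ N := hζV
    rwa [cayleyInvFun_cayleyFun (add_I_ne_zero hz0)] at this
  exact hz.2 (hNJ z hzN hz0)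

/-- `‖x + i‖ ≥ 1` and `‖x + i‖ ≥ |x|` for real `x`. [folklore] -/
theorem one_le_norm_ofReal_add_I (x : ℝ) : 1 ≤ ‖(x : ℂ) + I‖ ∧ |x| ≤ ‖(x : ℂ) + I‖ := by
  constructor
  · have := Complex.abs_im_le_norm ((x : ℂ) + I)
    simpa using this
  · have := Complex.abs_re_le_norm ((x : ℂ) + I)
    simpa using this

/-- `‖C(x) - 1‖ = 2/‖x + i‖` for real `x`. [folklore] -/
theorem norm_cayleyFun_sub_one (x : ℝ) : ‖cayleyFun x - 1‖ = 2 / ‖(x : ℂ) + I‖ := by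
  have hx : (x : ℂ) + I ≠ 0 := add_I_ne_zero (by simp)
  rw [cayleyFun_apply, show ((x : ℂ) - I) / ((x : ℂ) + I) - 1 = (-2 * I) / ((x : ℂ) + I) by
    field_simp; ring, norm_div]
  simp

/-- `‖C(x) + 1‖ = 2|x|/‖x + i‖` for real `x`. [folklore] -/
theorem norm_cayleyFun_add_one (x : ℝ) : ‖cayleyFun x + 1‖ = 2 * |x| / ‖(x : ℂ) + I‖ := by
  have hx : (x : ℂ) + I ≠ 0 := add_I_ne_zero (by simp)
  rw [cayleyFun_apply, show ((x : ℂ) - I) / ((x : ℂ) + I) + 1 = (2 * (x : ℂ)) / ((x : ℂ) + I) by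
    field_simp; ring, norm_div]
  simp

/-- **Localisation of a boundary piece.** For a chordal uniformizing map `φ` of `(D; a, b)` with
boundary extension `ψ`, every boundary piece `frontierPiece D k` is covered by the two compact
boundary arcs `ψ[r, R]` and `ψ[-R, -r]` for some `0 < r < R` (Carathéodory: the disc extension maps
the circle onto `∂D` with `1 ↦ b`, `-1 = C(0) ↦ a`; its circle parameters of the piece form a
closed set off `±1`). [cite: PommerenkeBBCM1992, Thm. 2.6] -/
theorem exists_Icc_cover_frontierPiece (h : JordanDomain.IsDiscExtension D.toJordanDomain φ Ψ)
    (hφ : D.IsChordalUniformizing φ) (k : ℕ) :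
    ∃ r R : ℝ, 0 < r ∧ r < R ∧ frontierPiece D k ⊆
      φ.boundaryExtension '' ((fun x : ℝ ↦ (x : ℂ)) '' Icc r R) ∪
        φ.boundaryExtension '' ((fun x : ℝ ↦ (x : ℂ)) '' Icc (-R) (-r)) := by
  have hb : Ψ 1 = D.pt 1 := h.apply_one_eq hφ.2
  have ha : Ψ (-1) = D.pt 0 := by
    rw [← cayleyFun_zero, ← h.boundaryExtension_eq (show (0 : ℝ) ≤ (0 : ℂ).im by simp)]
    exact JordanDomain.boundaryExtension_eq_of_hasBoundaryValue' φ (by simp) hφ.1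
  have hk : (0 : ℝ) < 1 / ((k : ℝ) + 1) := by positivity
  -- the closed set of circle parameters of the piece, off `1` and `-1`
  set Q : Set ℂ := closedBall (0 : ℂ) 1 ∩ Ψ ⁻¹' frontierPiece D k with hQ
  have hQc : IsClosed Q :=
    h.continuousOn.preimage_isClosed_of_isClosed isClosed_closedBall (isClosed_frontierPiece k)
  have h1Q : (1 : ℂ) ∉ Q := fun h1 ↦ by
    have : Ψ 1 ∈ frontierPiece D k := h1.2
    rw [hb] at this
    exact this.2 (Or.inr (mem_ball_self hk))
  have hm1Q : (-1 : ℂ) ∉ Q := fun h1 ↦ by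
    have : Ψ (-1) ∈ frontierPiece D k := h1.2
    rw [ha] at this
    exact this.2 (Or.inl (mem_ball_self hk))
  obtain ⟨ε₁, hε₁, hb₁⟩ := Metric.isOpen_iff.1 hQc.isOpen_compl 1 h1Q
  obtain ⟨ε₂, hε₂, hb₂⟩ := Metric.isOpen_iff.1 hQc.isOpen_compl (-1) hm1Q
  set ε : ℝ := min (min ε₁ ε₂) 1 with hε
  have hε0 : 0 < ε := lt_min (lt_min hε₁ hε₂) one_pos
  have hεle₁ : ε ≤ ε₁ := (min_le_left _ _).trans (min_le_left _ _)
  have hεle₂ : ε ≤ ε₂ := (min_le_left _ _).trans (min_le_right _ _)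
  have hε1 : ε ≤ 1 := min_le_right _ _
  refine ⟨ε / 2, 2 / ε, by positivity, ?_, fun w hw ↦ ?_⟩
  · rw [div_lt_div_iff₀ two_pos hε0]; nlinarith
  -- `w = Ψ ζ`, `ζ` on the circle, `ζ = C x` for a real `x`
  obtain ⟨ζ, hζ, rfl⟩ := h.bijOn_sphere.surjOn hw.1
  have hζ1 : ‖ζ‖ = 1 := mem_sphere_zero_iff_norm.1 hζ
  have hζQ : ζ ∈ Q := ⟨sphere_subset_closedBall hζ, hw⟩
  have hd₁ : ε ≤ dist ζ 1 := hεle₁.trans (not_lt.1 fun hlt ↦ hb₁ (mem_ball.2 hlt) hζQ)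
  have hd₂ : ε ≤ dist ζ (-1) := hεle₂.trans (not_lt.1 fun hlt ↦ hb₂ (mem_ball.2 hlt) hζQ)
  have hne1 : ζ ≠ 1 := by
    rintro rfl; rw [dist_self] at hd₁; exact absurd hd₁ (not_le.2 hε0)
  set x : ℝ := (cayleyInvFun ζ).re with hx
  have hCx : cayleyFun x = ζ := by
    rw [hx, ← cayleyInvFun_eq_ofReal_re hζ1, cayleyFun_cayleyInvFun hne1]
  have hψx : φ.boundaryExtension x = Ψ ζ := by
    rw [h.boundaryExtension_eq (by simp), hCx]
  -- the two distance bounds localise `|x|`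
  obtain ⟨hn1, hnx⟩ := one_le_norm_ofReal_add_I x
  have hnpos : 0 < ‖(x : ℂ) + I‖ := by linarith
  have hR : |x| ≤ 2 / ε := by
    rw [dist_eq_norm, ← hCx, norm_cayleyFun_sub_one] at hd₁
    rw [le_div_iff₀ hε0]
    have := (le_div_iff₀ hnpos).1 hd₁
    nlinarith
  have hr : ε / 2 ≤ |x| := by
    rw [dist_eq_norm, sub_neg_eq_add, ← hCx, norm_cayleyFun_add_one] at hd₂
    have := (le_div_iff₀ hnpos).1 hd₂
    nlinarith [abs_nonneg x]
  rcases le_or_gt 0 x with hx0 | hx0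
  · rw [abs_of_nonneg hx0] at hR hr
    exact Or.inl ⟨x, ⟨x, ⟨hr, hR⟩, rfl⟩, hψx⟩
  · rw [abs_of_neg hx0] at hR hr
    exact Or.inr ⟨x, ⟨x, ⟨by linarith, by linarith⟩, rfl⟩, hψx⟩

/-- **One collar.** A smooth `*`-hull `J ∌ 0` with restriction data `(Φ, d)`, containing the
`cl ℍ`-part of an open neighbourhood `N` of `K ⊆ cl ℍ`, yields a hull subdomain `D'` of
`(D; a, b)` (`exists_isHullSubdomain_of_isArcHull`) with restriction data of the same derivative
number `d` for `φ.pullbackHull D' = J` and with `cl D' ∩ ψ(K) = ∅`.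
[cite: LawlerSchrammWerner2003Restriction, §2 p. 8 (smooth hulls), transposed] -/
theorem exists_hullSubdomain_collar (hφ : D.IsChordalUniformizing φ)
    (h : JordanDomain.IsDiscExtension D.toJordanDomain φ Ψ)
    {J : Set ℂ} (hJ : IsArcHull J) (h0J : (0 : ℂ) ∉ J)
    {Φ : ConformalEquiv (upperHalfPlaneSet \ J) upperHalfPlaneSet} {d : ℝ}
    (hΦ : IsRestrictionMap J Φ) (hd : HasRestrictionDeriv J Φ d)
    {N K : Set ℂ} (hN : IsOpen N) (hNJ : ∀ z ∈ N, 0 ≤ z.im → z ∈ J) (hK : K ⊆ N)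
    (hKim : ∀ z ∈ K, 0 ≤ z.im) :
    ∃ (D' : DobrushinDomain)
      (Ψ' : ConformalEquiv (upperHalfPlaneSet \ φ.pullbackHull D') upperHalfPlaneSet),
      D.IsHullSubdomain D' ∧ IsRestrictionMap (φ.pullbackHull D') Ψ' ∧
      HasRestrictionDeriv (φ.pullbackHull D') Ψ' d ∧
      Disjoint (closure D'.carrier) (φ.boundaryExtension '' K) := by
  obtain ⟨D', hD', hcar⟩ := exists_isHullSubdomain_of_isArcHull JordanCurveTheorem_holds
    JordanDomain.exists_continuousOn_extension_holds hφ hJ h0J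
  have hpull : φ.pullbackHull D' = J := pullbackHull_eq_of_carrier_eq hJ.1 hcar
  obtain ⟨Ψ', hΨ', hΨ'd⟩ := exists_restrictionData_of_eq hpull.symm hΦ hd
  refine ⟨D', Ψ', hD', hΨ', hΨ'd, ?_⟩
  rw [hcar]
  exact disjoint_closure_image h hN hNJ hK hKim

end Boundary

/-! ### Collar families from lattice restriction limits -/

section Collars

variable {D : DobrushinDomain} {a b : ℝ → HexVertex}
  {φ : ConformalEquiv upperHalfPlaneSet D.carrier} {Ψ : ℂ → ℂ}

/-- **A collar family from collar data and the restriction limits.** Given the per-domain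
restriction limits (`P_δ(D'-mesh walk) → Φ'_A(0)^{5/8}` for every hull subdomain with restriction
data), collar data for `K` with derivative numbers `d_j → 1` yield subdomains `Ω'_j` with
`cl Ω'_j ∩ ψ(K) = ∅` and containment probabilities tending to `p_j = d_j^{5/8} → 1`.
[cite: LawlerSchrammWerner2003Restriction, Lemma 3.2 and Thm. 6.1 (transposed)] -/
theorem exists_collarFamily (hφ : D.IsChordalUniformizing φ)
    (h : JordanDomain.IsDiscExtension D.toJordanDomain φ Ψ)
    (H : ∀ (D' : DobrushinDomain) (φ : ConformalEquiv upperHalfPlaneSet D.carrier)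
      (Φ : ConformalEquiv (upperHalfPlaneSet \ φ.pullbackHull D') upperHalfPlaneSet) (d : ℝ),
      D.IsHullSubdomain D' → D.IsChordalUniformizing φ →
      IsRestrictionMap (φ.pullbackHull D') Φ → HasRestrictionDeriv (φ.pullbackHull D') Φ d →
      Tendsto (fun δ : ℝ => ((hexSAWLaw D.carrier δ (a δ) (b δ))
        {γ | (∀ v ∈ γ.walk.support, v ∈ embMeshVertices hexCenter D'.carrier δ) ∧
          ∀ e ∈ γ.walk.darts,
            (embMeshGraph hexGraph hexCenter D'.carrier δ).Adj e.fst e.snd}).toReal)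
        (𝓝[>] 0) (𝓝 (d ^ ((5 : ℝ) / 8))))
    {K : Set ℂ} (hKim : ∀ z ∈ K, 0 ≤ z.im) {d : ℕ → ℝ} (hd : Tendsto d atTop (𝓝 1))
    (hdata : ∀ j : ℕ, ∃ (J N : Set ℂ)
      (Φ : ConformalEquiv (upperHalfPlaneSet \ J) upperHalfPlaneSet),
      IsArcHull J ∧ (0 : ℂ) ∉ J ∧ IsRestrictionMap J Φ ∧ HasRestrictionDeriv J Φ (d j) ∧
      IsOpen N ∧ (∀ z ∈ N, 0 ≤ z.im → z ∈ J) ∧ K ⊆ N) :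
    ∃ (Ω' : ℕ → Set ℂ) (p : ℕ → ℝ), Tendsto p atTop (𝓝 1) ∧
      (∀ j, Disjoint (closure (Ω' j)) (φ.boundaryExtension '' K)) ∧
      ∀ j, Tendsto (fun δ : ℝ => ((hexSAWLaw D.carrier δ (a δ) (b δ))
        {γ | (∀ v ∈ γ.walk.support, v ∈ embMeshVertices hexCenter (Ω' j) δ) ∧
          ∀ e ∈ γ.walk.darts,
            (embMeshGraph hexGraph hexCenter (Ω' j) δ).Adj e.fst e.snd}).toReal)
        (𝓝[>] 0) (𝓝 (p j)) := by
  have key : ∀ j : ℕ, ∃ D' : DobrushinDomain,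
      Disjoint (closure D'.carrier) (φ.boundaryExtension '' K) ∧
      Tendsto (fun δ : ℝ => ((hexSAWLaw D.carrier δ (a δ) (b δ))
        {γ | (∀ v ∈ γ.walk.support, v ∈ embMeshVertices hexCenter D'.carrier δ) ∧
          ∀ e ∈ γ.walk.darts,
            (embMeshGraph hexGraph hexCenter D'.carrier δ).Adj e.fst e.snd}).toReal)
        (𝓝[>] 0) (𝓝 (d j ^ ((5 : ℝ) / 8))) := by
    intro j
    obtain ⟨J, N, Φ, hJ, h0J, hΦ, hdj, hN, hNJ, hK⟩ := hdata j
    obtain ⟨D', Ψ', hD', hΨ', hΨ'd, hdisj⟩ :=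
      exists_hullSubdomain_collar hφ h hJ h0J hΦ hdj hN hNJ hK hKim
    exact ⟨D', hdisj, H D' φ Ψ' (d j) hD' hφ hΨ' hΨ'd⟩
  choose D' hdisj hlim using key
  refine ⟨fun j ↦ (D' j).carrier, fun j ↦ d j ^ ((5 : ℝ) / 8), ?_, hdisj, hlim⟩
  have := hd.rpow_const (p := (5 : ℝ) / 8) (Or.inl one_ne_zero)
  rwa [Real.one_rpow] at this

/-- **Registered sub-goal `stub_chordalCarrier_collars`** (crux item stmt-CriticalPhenomena-10472,
line `floor-ratio-restriction-bootstrap`, stub `stub_chordalCarrier`, geometric input of boundary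
avoidance): for EVERY Dobrushin domain `(D; a, b)` and lattice endpoints, the per-domain restriction
limits (`P_δ(the walk is a D'-mesh walk) → Φ'_A(0)^{5/8}` for every hull subdomain `D' = φ(ℍ ∖ A)`
with restriction data) imply the COLLAR hypothesis of `stub_chordalCarrier_reduction`: every
boundary piece `frontierPiece D k` is covered by two closed sets, each avoided by the closures of
a sequence of subdomains whose containment probabilities tend to `1` (half-ellipse hulls on the
positive axis and their reflections, `Φ'_B(0) = ellDeriv → 1`).
[cite: LawlerSchrammWerner2003Restriction, §2 p. 8, Lemma 3.2 and Thm. 6.1 (transposed)] -/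
theorem stub_chordalCarrier_collars :
    ∀ (D : DobrushinDomain) (a b : ℝ → HexVertex),
    (∀ (D' : DobrushinDomain) (φ : ConformalEquiv upperHalfPlaneSet D.carrier)
      (Φ : ConformalEquiv (upperHalfPlaneSet \ φ.pullbackHull D') upperHalfPlaneSet) (d : ℝ),
      D.IsHullSubdomain D' → D.IsChordalUniformizing φ →
      IsRestrictionMap (φ.pullbackHull D') Φ → HasRestrictionDeriv (φ.pullbackHull D') Φ d →
      Tendsto (fun δ : ℝ => ((hexSAWLaw D.carrier δ (a δ) (b δ))
        {γ | (∀ v ∈ γ.walk.support, v ∈ embMeshVertices hexCenter D'.carrier δ) ∧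
          ∀ e ∈ γ.walk.darts,
            (embMeshGraph hexGraph hexCenter D'.carrier δ).Adj e.fst e.snd}).toReal)
        (𝓝[>] 0) (𝓝 (d ^ ((5 : ℝ) / 8)))) →
    ∀ k : ℕ, ∃ Z₁ Z₂ : Set ℂ, IsClosed Z₁ ∧ IsClosed Z₂ ∧
      frontierPiece D k ⊆ Z₁ ∪ Z₂ ∧ ∀ Z ∈ ({Z₁, Z₂} : Set (Set ℂ)),
        ∃ (Ω' : ℕ → Set ℂ) (p : ℕ → ℝ), Tendsto p atTop (𝓝 1) ∧
          (∀ j, Disjoint (closure (Ω' j)) Z) ∧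
          ∀ j, Tendsto (fun δ : ℝ => ((hexSAWLaw D.carrier δ (a δ) (b δ))
            {γ | (∀ v ∈ γ.walk.support, v ∈ embMeshVertices hexCenter (Ω' j) δ) ∧
              ∀ e ∈ γ.walk.darts,
                (embMeshGraph hexGraph hexCenter (Ω' j) δ).Adj e.fst e.snd}).toReal)
            (𝓝[>] 0) (𝓝 (p j)) := by
  intro D a b H k
  obtain ⟨φ, hφ⟩ := MarkedDomain.exists_isChordalUniformizing_holds D
  obtain ⟨Ψ, h⟩ := JordanDomain.exists_isDiscExtension JordanDomain.exists_continuousOn_extension_holds φ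
  obtain ⟨r, R, hr, hrR, hcov⟩ := exists_Icc_cover_frontierPiece h hφ k
  have hreal : ∀ u v : ℝ, (fun x : ℝ ↦ (x : ℂ)) '' Icc u v ⊆ closure upperHalfPlaneSet := by
    rintro u v _ ⟨x, -, rfl⟩
    exact mem_closure_upperHalfPlaneSet_iff.2 (by simp)
  have him : ∀ u v : ℝ, ∀ z ∈ (fun x : ℝ ↦ (x : ℂ)) '' Icc u v, 0 ≤ z.im := by
    rintro u v _ ⟨x, -, rfl⟩; simp
  have hclosed : ∀ u v : ℝ,
      IsClosed (φ.boundaryExtension '' ((fun x : ℝ ↦ (x : ℂ)) '' Icc u v)) := fun u v ↦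
    (MarkedDomain.isCompact_image_boundaryExtension JordanDomain.exists_continuousOn_extension_holds (hreal u v)
      (isCompact_Icc.image continuous_ofReal)).isClosed
  obtain ⟨d, hd, hdata⟩ := exists_plusData hr hrR
  refine ⟨_, _, hclosed r R, hclosed (-R) (-r), hcov, ?_⟩
  rintro Z hZ
  simp only [mem_insert_iff, mem_singleton_iff] at hZ
  rcases hZ with rfl | rfl
  · exact exists_collarFamily hφ h H (him r R) hd hdata
  · refine exists_collarFamily hφ h H (him (-R) (-r)) hd fun j ↦ ?_
    rw [← imagAxisRefl_image_ofReal_Icc r R]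
    exact reflect_data (hdata j)

end Collars

end Summit.CriticalPhenomena.SAWScalingLimit.Theorems.ObservableToSLE.FloorRatio

end
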